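import Mathlib
import Literature.MathematicalPhysics.QuantumLattice.HubbardBandSectorCountingToolbox
import HarnessLib

/-!
# Four-sector counting, fold ranges: the SHARP level count of the diagonal function near a nondegenerate minimum

Topic `Literature/MathematicalPhysics/QuantumLattice`; sub-namespace `BandSectorCounting` (continues `HubbardBandSectorCountingToolbox`).
Part (F3b) of the log-free ANISOTROPIC anchored four-sector counting lemma («E1-P2-THIN-COUNT», cell gate-hubbard-kl, plan g17 (R41); seat p4; plan
HOME/prover-p4/E1-P2-THIN-COUNT-PLAN.md §Refinement 4).  In the fold ranges the per-anti-diagonal count is `≍ δ/(w√|D(σ)|)` (`gridCount_L5`, `D(σ) = h(σ,σ)`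
the diagonal function), and the isotropic proof sums it through the level counts `#{σ : |D(σ)| ≤ η} ≤ Xη/w + Y√η/w + Z` (`count_levels_diag`) over dyadic
levels `η`: the `Y√η/w` term — rows near a critical point of `D` — contributes `Y·δ/w²` at EVERY level, hence the dyadic depth factor `(J+1)` (the second
logarithm of `count_pairs_exists`; Mastropietro p. 229).  Near a NONDEGENERATE MINIMUM `σ_c` of `D` with value `D_c < 0` (the umklapp-corner rows whose
anti-diagonal does cross the level `0`) the level sets are in fact much thinner than `√η`: on `{D ∈ [−2η, −η]}` one has `|σ − σ_c| ≥ √(|D_c|/A)` as soon as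
`4η ≤ |D_c|`, so `|D′| ≥ c₂√(|D_c|/A)` there and the level set has length `≤ η√A/(c₂√|D_c|)` on each side.  Summed against `δ/(w√η)` this gives
`Σ_η √η · δ√A/(c₂√|D_c| w²) = O(δ/w²)` uniformly in `D_c` (a discrete arcsine integral) — no logarithm.  This file is that level count, as pure
one-variable calculus on a grid `x₀ + i·h`:

* **`level_count_near_min_sharp`** — `c₂ ≤ g″ ≤ A` on `[σ_c − R, σ_c + R]`, `g′(σ_c) = 0`, `g(σ_c) = D_c < 0`, `0 < η`, `4η ≤ −D_c`:
  `#{i < N : xᵢ ∈ [σ_c − R, σ_c + R], g(xᵢ) ∈ [−2η, −η]} ≤ 2·(η√A/(c₂√(−D_c))/h + 1)`;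
* **`level_count_near_min_crude`** — `c₂ ≤ g″` only: `#{i < N : xᵢ ∈ [σ_c − R, σ_c + R], g(xᵢ) ≤ 2η} ≤ 2√(2(2η − D_c)/c₂)/h + 1` (all levels, any sign of `D_c`).

Everything is PROVED; no definitions, no named facts.

## Sources

* G. Benfatto, A. Giuliani, V. Mastropietro, Ann. Henri Poincaré 7 (2006) 809–898, Lemma 3.1 / App. A2–A3. [BenfattoGiulianiMastropietro2006]
* V. Mastropietro, *Non-Perturbative Renormalization* (World Scientific, 2008), ch. 14, (14.67) p. 223; p. 229. [Mastropietro2008]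
-/

noncomputable section

open Real Set

namespace Literature.MathematicalPhysics.QuantumLattice.BandSectorCounting

/-- First-derivative growth away from a critical point: `g″ ≥ c₂` on `[x, y]` gives `g′ z − g′ x ≥ c₂ (z − x)` for `z ∈ [x, y]`. [folklore] -/
private theorem deriv_growth_right {g' g'' : ℝ → ℝ} (hg' : ∀ z, HasDerivAt g' (g'' z) z) {x y c₂ : ℝ}
    (h : ∀ z ∈ Icc x y, c₂ ≤ g'' z) {z : ℝ} (hz : z ∈ Icc x y) : c₂ * (z - x) ≤ g' z - g' x := by
  have hd' : ∀ z, HasDerivAt g' (deriv g' z) z := fun z => by rw [(hg' z).deriv]; exact hg' z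
  exact (convex_Icc x y).mul_sub_le_image_sub_of_le_deriv
    (fun t _ => (hd' t).continuousAt.continuousWithinAt)
    (fun t _ => (hd' t).differentiableAt.differentiableWithinAt)
    (fun t ht => by rw [(hg' t).deriv]; exact h t (interior_subset ht)) x
    (left_mem_Icc.2 (hz.1.trans hz.2)) z hz hz.1

/-- Mirror image: `g″ ≥ c₂` on `[x, y]` gives `g′ y − g′ z ≥ c₂ (y − z)` for `z ∈ [x, y]`. [folklore] -/
private theorem deriv_growth_left {g' g'' : ℝ → ℝ} (hg' : ∀ z, HasDerivAt g' (g'' z) z) {x y c₂ : ℝ}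
    (h : ∀ z ∈ Icc x y, c₂ ≤ g'' z) {z : ℝ} (hz : z ∈ Icc x y) : c₂ * (y - z) ≤ g' y - g' z := by
  have hd' : ∀ z, HasDerivAt g' (deriv g' z) z := fun z => by rw [(hg' z).deriv]; exact hg' z
  exact (convex_Icc x y).mul_sub_le_image_sub_of_le_deriv
    (fun t _ => (hd' t).continuousAt.continuousWithinAt)
    (fun t _ => (hd' t).differentiableAt.differentiableWithinAt)
    (fun t ht => by rw [(hg' t).deriv]; exact h t (interior_subset ht)) z hz y
    (right_mem_Icc.2 (hz.1.trans hz.2)) hz.2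

/-- Second-order UPPER bound to the right: `g″ ≤ A` on `[x, y]` gives `g y ≤ g x + g′ x (y − x) + (A/2)(y − x)²`. [folklore] -/
private theorem quadratic_upper_right {g g' g'' : ℝ → ℝ} (hg : ∀ z, HasDerivAt g (g' z) z)
    (hg' : ∀ z, HasDerivAt g' (g'' z) z) {x y A : ℝ} (hxy : x ≤ y) (h : ∀ z ∈ Icc x y, g'' z ≤ A) :
    g y ≤ g x + g' x * (y - x) + A / 2 * (y - x) ^ 2 := by
  have := quadratic_lower_right (g := fun z => -g z) (g' := fun z => -g' z) (g'' := fun z => -g'' z)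
    (fun z => (hg z).neg) (fun z => (hg' z).neg) hxy (c₂ := -A) (fun z hz => by linarith [h z hz])
  linarith

/-- Second-order UPPER bound to the left: `g″ ≤ A` on `[x, y]` gives `g x ≤ g y + g′ y (x − y) + (A/2)(x − y)²`. [folklore] -/
private theorem quadratic_upper_left {g g' g'' : ℝ → ℝ} (hg : ∀ z, HasDerivAt g (g' z) z)
    (hg' : ∀ z, HasDerivAt g' (g'' z) z) {x y A : ℝ} (hxy : x ≤ y) (h : ∀ z ∈ Icc x y, g'' z ≤ A) :
    g x ≤ g y + g' y * (x - y) + A / 2 * (x - y) ^ 2 := by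
  have := quadratic_lower_left (g := fun z => -g z) (g' := fun z => -g' z) (g'' := fun z => -g'' z)
    (fun z => (hg z).neg) (fun z => (hg' z).neg) hxy (c₂ := -A) (fun z hz => by linarith [h z hz])
  linarith

/-- **Sharp level count near a nondegenerate minimum.**  Let `c₂ ≤ g″ ≤ A` on `I = [σ_c − R, σ_c + R]`, `g′(σ_c) = 0`, `g(σ_c) = D_c < 0`, and
`0 < η`, `4η ≤ −D_c`.  Then on `I ∩ {g ∈ [−2η, −η]}` one has `|σ − σ_c| ≥ √(−D_c/A)` and `|g′| ≥ c₂√(−D_c/A)`, so the grid points `xᵢ = x₀ + i·h` there number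
`≤ 2·(η√A/(c₂√(−D_c))/h + 1)` (one cluster of length `≤ η/(c₂√(−D_c/A))` on each side of `σ_c`).  Replaces the `√η/w` of `count_levels_diag` at levels
`η ≤ |D_c|/4`. [cite: BenfattoGiulianiMastropietro2006, Lemma 3.1 / App. A2] -/
theorem level_count_near_min_sharp {g g' g'' : ℝ → ℝ} (hg : ∀ z, HasDerivAt g (g' z) z)
    (hg' : ∀ z, HasDerivAt g' (g'' z) z) {σc R c₂ A Dc η : ℝ} (hc₂ : 0 < c₂) (hA : 0 < A)
    (hcrit : g' σc = 0) (hval : g σc = Dc) (hη : 0 < η) (hη4 : 4 * η ≤ -Dc)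
    (hlo : ∀ z ∈ Icc (σc - R) (σc + R), c₂ ≤ g'' z) (hhi : ∀ z ∈ Icc (σc - R) (σc + R), g'' z ≤ A)
    {x₀ h : ℝ} (hh : 0 < h) (N : ℕ) :
    ((((Finset.range N).filter fun i : ℕ =>
        x₀ + i * h ∈ Icc (σc - R) (σc + R) ∧ g (x₀ + i * h) ∈ Icc (-2 * η) (-η)).card : ℝ)) ≤
      2 * (η * Real.sqrt A / (c₂ * Real.sqrt (-Dc)) / h + 1) := by
  classical
  have hDc : 0 < -Dc := by linarith
  set smin := Real.sqrt (-Dc / A) with hsmin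
  have hsmin0 : 0 < smin := Real.sqrt_pos.2 (div_pos hDc hA)
  set lam := c₂ * smin with hlam
  have hlam0 : 0 < lam := mul_pos hc₂ hsmin0
  set ℓ := η / lam with hℓ
  have hℓ0 : 0 ≤ ℓ := div_nonneg hη.le hlam0.le
  -- the length bound equals the stated one
  have hℓeq : ℓ = η * Real.sqrt A / (c₂ * Real.sqrt (-Dc)) := by
    rw [hℓ, hlam, hsmin, Real.sqrt_div hDc.le]
    have hsA : 0 < Real.sqrt A := Real.sqrt_pos.2 hA
    have hsD : 0 < Real.sqrt (-Dc) := Real.sqrt_pos.2 hDc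
    field_simp
  -- (1) on the level set, `|σ − σ_c| ≥ smin`
  have hfar : ∀ σ ∈ Icc (σc - R) (σc + R), -2 * η ≤ g σ → smin ≤ |σ - σc| := by
    intro σ hσ hgσ
    have hsq : -Dc / A ≤ (σ - σc) ^ 2 := by
      rw [div_le_iff₀ hA]
      rcases le_total σc σ with hle | hle
      · have hup := quadratic_upper_right hg hg' hle (A := A) (fun z hz => hhi z ⟨by linarith [hz.1, hσ.1, hσ.2], hz.2.trans hσ.2⟩)
        rw [hcrit, hval, zero_mul, add_zero] at hup
        nlinarith
      · have hup := quadratic_upper_left hg hg' hle (A := A) (fun z hz => hhi z ⟨hσ.1.trans hz.1, by linarith [hz.2, hσ.1, hσ.2]⟩)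
        rw [hcrit, hval, zero_mul, add_zero] at hup
        nlinarith
    calc smin = Real.sqrt (-Dc / A) := hsmin
      _ ≤ Real.sqrt ((σ - σc) ^ 2) := Real.sqrt_le_sqrt hsq
      _ = |σ - σc| := Real.sqrt_sq_eq_abs _
  -- (2) `|g′ z| ≥ c₂ |z − σ_c|` on `I`
  have hder : ∀ z ∈ Icc (σc - R) (σc + R), c₂ * |z - σc| ≤ |g' z| := by
    intro z hz
    rcases le_total σc z with hle | hle
    · have := deriv_growth_right hg' (x := σc) (y := σc + R) (fun u hu => hlo u ⟨by linarith [hu.1, hz.1, hz.2], hu.2⟩) ⟨hle, hz.2⟩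
      rw [hcrit, sub_zero] at this
      rw [abs_of_nonneg (sub_nonneg.2 hle)]
      exact this.trans (le_abs_self _)
    · have := deriv_growth_left hg' (x := σc - R) (y := σc) (fun u hu => hlo u ⟨hu.1, by linarith [hu.2, hz.1, hz.2]⟩) ⟨hz.1, hle⟩
      rw [hcrit, zero_sub] at this
      rw [abs_of_nonpos (sub_nonpos.2 hle), neg_sub]
      exact this.trans (by rw [← abs_neg]; exact le_abs_self _)
  -- (3) two level points on the same side of `σ_c` are within `ℓ`
  have hpair : ∀ σ₁ σ₂ : ℝ, σ₁ ≤ σ₂ → σ₁ ∈ Icc (σc - R) (σc + R) → σ₂ ∈ Icc (σc - R) (σc + R) →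
      g σ₁ ∈ Icc (-2 * η) (-η) → g σ₂ ∈ Icc (-2 * η) (-η) → (σc ≤ σ₁ ∨ σ₂ ≤ σc) → σ₂ - σ₁ ≤ ℓ := by
    intro σ₁ σ₂ h12 hσ₁ hσ₂ hg₁ hg₂ hside
    have hmin : ∀ z ∈ Icc σ₁ σ₂, lam ≤ |g' z| := by
      intro z hz
      have hzI : z ∈ Icc (σc - R) (σc + R) := ⟨hσ₁.1.trans hz.1, hz.2.trans hσ₂.2⟩
      refine le_trans ?_ (hder z hzI)
      rw [hlam]
      refine mul_le_mul_of_nonneg_left ?_ hc₂.le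
      rcases hside with hs | hs
      · -- right side: `z − σ_c ≥ σ₁ − σ_c ≥ smin`
        have h1 := hfar σ₁ hσ₁ hg₁.1
        rw [abs_of_nonneg (by linarith : 0 ≤ σ₁ - σc)] at h1
        rw [abs_of_nonneg (by linarith [hz.1] : 0 ≤ z - σc)]
        linarith [hz.1]
      · have h2 := hfar σ₂ hσ₂ hg₂.1
        rw [abs_of_nonpos (by linarith : σ₂ - σc ≤ 0)] at h2
        rw [abs_of_nonpos (by linarith [hz.2] : z - σc ≤ 0)]
        linarith [hz.2]
    have hlow := mul_sub_le_abs_sub_of_le_abs_deriv hg h12 hlam0 hmin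
    have hup : |g σ₂ - g σ₁| ≤ η := by
      rw [abs_le]; constructor <;> linarith [hg₁.1, hg₁.2, hg₂.1, hg₂.2]
    rw [hℓ, le_div_iff₀ hlam0]; nlinarith
  -- (4) count: split the index set by side
  set P : ℕ → Prop := fun i => x₀ + i * h ∈ Icc (σc - R) (σc + R) ∧ g (x₀ + i * h) ∈ Icc (-2 * η) (-η) with hP
  set S := (Finset.range N).filter P with hS
  set S₁ := S.filter (fun i : ℕ => σc ≤ x₀ + i * h) with hS₁
  set S₂ := S.filter (fun i : ℕ => ¬ σc ≤ x₀ + i * h) with hS₂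
  have hsplit : S.card = S₁.card + S₂.card := by
    rw [hS₁, hS₂]; exact (Finset.card_filter_add_card_filter_not _).symm
  have hdiam : ∀ T : Finset ℕ, (∀ i ∈ T, P i) → ((∀ i ∈ T, σc ≤ x₀ + i * h) ∨ (∀ i ∈ T, x₀ + i * h ≤ σc)) →
      (T.card : ℝ) ≤ ℓ / h + 1 := by
    intro T hT hsideT
    refine natCard_le_of_diam (div_nonneg hℓ0 hh.le) fun i hi j hj => ?_
    rcases le_total i j with hij | hij
    · have hij' : (i : ℝ) ≤ j := by exact_mod_cast hij
      have h12 : x₀ + i * h ≤ x₀ + j * h := by nlinarith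
      have hside : σc ≤ x₀ + i * h ∨ x₀ + j * h ≤ σc := by
        rcases hsideT with hs | hs
        · exact Or.inl (hs i hi)
        · exact Or.inr (hs j hj)
      have := hpair _ _ h12 (hT i hi).1 (hT j hj).1 (hT i hi).2 (hT j hj).2 hside
      rw [le_div_iff₀ hh]; nlinarith
    · have hij' : (j : ℝ) ≤ i := by exact_mod_cast hij
      have : ((j : ℝ) - i) ≤ 0 := by linarith
      exact this.trans (div_nonneg hℓ0 hh.le)
  have h1 : (S₁.card : ℝ) ≤ ℓ / h + 1 := by
    refine hdiam S₁ (fun i hi => ?_) (Or.inl fun i hi => ?_)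
    · rw [hS₁, Finset.mem_filter, hS, Finset.mem_filter] at hi; exact hi.1.2
    · rw [hS₁, Finset.mem_filter] at hi; exact hi.2
  have h2 : (S₂.card : ℝ) ≤ ℓ / h + 1 := by
    refine hdiam S₂ (fun i hi => ?_) (Or.inr fun i hi => ?_)
    · rw [hS₂, Finset.mem_filter, hS, Finset.mem_filter] at hi; exact hi.1.2
    · rw [hS₂, Finset.mem_filter] at hi; exact (not_le.1 hi.2).le
  have : (S.card : ℝ) = S₁.card + S₂.card := by exact_mod_cast hsplit
  rw [this, ← hℓeq]; linarith

/-- **Crude level count near a nondegenerate minimum** (all levels): with `c₂ ≤ g″` on `I = [σ_c − R, σ_c + R]`, `g′(σ_c) = 0`, `g(σ_c) = D_c`,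
every `σ ∈ I` with `g(σ) ≤ 2η` has `|σ − σ_c| ≤ √(2(2η − D_c)/c₂)`, so the grid points number `≤ 2√(2(2η − D_c)/c₂)/h + 1` (`= 1` if `2η < D_c`).
[cite: BenfattoGiulianiMastropietro2006, Lemma 3.1 / App. A2] -/
theorem level_count_near_min_crude {g g' g'' : ℝ → ℝ} (hg : ∀ z, HasDerivAt g (g' z) z)
    (hg' : ∀ z, HasDerivAt g' (g'' z) z) {σc R c₂ Dc η : ℝ} (hc₂ : 0 < c₂)
    (hcrit : g' σc = 0) (hval : g σc = Dc)
    (hlo : ∀ z ∈ Icc (σc - R) (σc + R), c₂ ≤ g'' z) {x₀ h : ℝ} (hh : 0 < h) (N : ℕ) :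
    ((((Finset.range N).filter fun i : ℕ =>
        x₀ + i * h ∈ Icc (σc - R) (σc + R) ∧ g (x₀ + i * h) ≤ 2 * η).card : ℝ)) ≤
      2 * Real.sqrt (2 * (2 * η - Dc) / c₂) / h + 1 := by
  classical
  set r := Real.sqrt (2 * (2 * η - Dc) / c₂) with hr
  have hr0 : 0 ≤ r := Real.sqrt_nonneg _
  -- every admissible point is within `r` of `σ_c`
  have hnear : ∀ σ ∈ Icc (σc - R) (σc + R), g σ ≤ 2 * η → |σ - σc| ≤ r := by
    intro σ hσ hgσ
    have hsq : (σ - σc) ^ 2 ≤ 2 * (2 * η - Dc) / c₂ := by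
      rw [le_div_iff₀ hc₂]
      rcases le_total σc σ with hle | hle
      · have hlow := quadratic_lower_right hg hg' hle (c₂ := c₂) (fun z hz => hlo z ⟨by linarith [hz.1, hσ.1, hσ.2], hz.2.trans hσ.2⟩)
        rw [hcrit, hval, zero_mul, add_zero] at hlow
        nlinarith
      · have hlow := quadratic_lower_left hg hg' hle (c₂ := c₂) (fun z hz => hlo z ⟨hσ.1.trans hz.1, by linarith [hz.2, hσ.1, hσ.2]⟩)
        rw [hcrit, hval, zero_mul, add_zero] at hlow
        nlinarith
    calc |σ - σc| = Real.sqrt ((σ - σc) ^ 2) := (Real.sqrt_sq_eq_abs _).symm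
      _ ≤ r := Real.sqrt_le_sqrt hsq
  refine natCard_le_of_diam (by positivity) fun i hi j hj => ?_
  rw [Finset.mem_filter] at hi hj
  have h1 := hnear _ hi.2.1 hi.2.2
  have h2 := hnear _ hj.2.1 hj.2.2
  have : ((j : ℝ) - i) * h ≤ 2 * r := by
    have e : ((j : ℝ) - i) * h = (x₀ + j * h - σc) - (x₀ + i * h - σc) := by ring
    rw [e]
    have := abs_sub_abs_le_abs_sub (x₀ + j * h - σc) (x₀ + i * h - σc)
    linarith [le_abs_self ((x₀ + j * h - σc) - (x₀ + i * h - σc)), abs_sub (x₀ + j * h - σc) (x₀ + i * h - σc)]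
  rw [le_div_iff₀ hh]; linarith
end Literature.MathematicalPhysics.QuantumLattice.BandSectorCounting

end
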